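import Summits.QuantumFields.BalabanUV.T4Continuum.Spine.NE3.LandauCorrectionSupB8LocalGauge
import Mathlib.Algebra.Order.Chebyshev
import HarnessLib

/-!
# T⁴ programme, node NE3 — census R40 (file (iii′)): THE COVARIANT LATTICE MEAN-VALUE INEQUALITY ON THE TORUS
# `‖u‖_∞ ≤ 2·√(S₂∕(2R+1)^d) + 8dRR′·‖Δ_W u‖_∞` — from the interior GRADIENT estimate, with NO Green function

Cell `pub-balaban-gaps` (YM blitz, track G2, seat `ne3`, unit `pub-balaban-gaps-ne3-g8`; writer prover-pub-balaban-gaps-ne3-g8-0, 2026-08-24), census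
`run/shared/lean/pub/pub-balaban-gaps/ne/NE3.md` §4 R40.  WHY.  The LAST analytic input of THE END's sup letter `hK(cavg L U_B)` after gen 8 is (HR_W) — the `ℓ^∞` bound of
B8's (1.38)-projection at a CURVED background.  R38 proved the flat case in three steps; its step (iii), the torus-wide sup Poincaré inequality «mean zero ⇒
`‖g‖_∞ ≤ 16d³(NM)²‖Δ_1g‖_∞`», has NO curved analogue (no covariantly constant section on the torus).  Its replacement is a MEAN-VALUE INEQUALITY, and on the
lattice it follows from the interior gradient estimate of R37∕R39 by SCALAR averaging — this file:

* §1 **`gaugeDir_le_raw`** — the RAW interior gradient estimate at a curved background with local near-identity gauges (the content of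
  `SupRegularityLocalGauge.supRegularity_of_localGauge` WITHOUT the block-mean closure `‖u‖_∞ ≤ C_U‖D_Wu‖_∞`): for `P`-periodic `u` with `‖u‖_∞ ≤ U`,
  `‖Δ_Wu‖_∞ ≤ B` and `16Rda ≤ 1∕2`: `‖D_Wu‖_∞ ≤ 4(2d∕R + 4Rδ + 24Rda² + 2a)·U + 4R·B` (obtained from the closed theorem by the choice `C_U = U∕G`).
* §2 **`card_mul_norm_le`** — scalar averaging: `(2R+1)^d‖u(x₀)‖ ≤ Σ_{m ∈ [−R,R]^d}‖u(x₀+m)‖ + (2R+1)^d·dR·G` (the covariant Lipschitz bound of the NORM,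
  `LandauCorrectionSupB8LocalGauge.abs_norm_sub_norm_le`), and its Cauchy–Schwarz form **`norm_le_sqrt_add`**: `‖u(x₀)‖ ≤ √(S₂∕(2R+1)^d) + dR·G` whenever
  `Σ_{m}‖u(x₀+m)‖² ≤ S₂`.
* §3 **`sup_le_meanValue`** — the two combined under the line `4dR·(2d∕R′ + 4R′δ + 24R′da² + 2a) ≤ 1∕2` (gauge radius `R′`, averaging radius `R`):
  `‖u‖_∞ ≤ 2√(S₂∕(2R+1)^d) + 8dRR′·‖Δ_Wu‖_∞` — M-free when `R ≍ R′ ≍ M`, `S₂ ≲ (NM)^dB²`-type and `‖Δ_Wu‖_∞ ≲ M^{−2}`-type, exactly the sizes of R38's step (iii).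

HONEST: lattice analysis at a fixed background; nothing of Bałaban's asserted; (HR_W) itself is NOT proved here (the curved inverse inequality, census R40 (ii), is the
other half); NE3 NOT proved; spine 0∕9; NOT continuum ∕ Clay.
-/

set_option autoImplicit false

open scoped BigOperators Matrix Matrix.Norms.L2Operator
open NormedSpace Finset

namespace Summit.QuantumFields.BalabanUV.T4Continuum.NE3.CovariantMeanValue

open Literature.MathematicalPhysics.QuantumFieldTheory.Balaban1983to89
open B7Prop1Explicit B7Prop2Explicit MatrixNorms
open T4AveragingDeficitWall (Ad IsUnitaryCfg)
open T4AveragingDeficitWallBoundary (IsPeriodicCfg periodBox mem_periodBox)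
open AveragingDeficitPeriodicCounting (IsPeriodicDir)
open AveragingDeficitTorusChart (periodic_smul_vec)
open BlockAveragePushDirGauge (gaugeDir isPeriodicDir_gaugeDir)
open SkeletonLattice (cdiv cmod smul_cdiv_add_cmod cmod_nonneg cmod_lt)
open NE3.PairLandauB8 (covLapSite)
open NE3.SupRegularityLocalGauge (supRegularity_of_localGauge)
open NE3.LandauCorrectionSupB8LocalGauge (abs_norm_sub_norm_le)

noncomputable section

variable {d : ℕ} {n : Type*} [Fintype n] [DecidableEq n]

/-! ## §1 The raw interior gradient estimate at a curved background -/

/-- **THE RAW INTERIOR GRADIENT ESTIMATE** (`d ≥ 1`; `W` unitary `P`-periodic; `u` `P`-periodic with `‖u‖_∞ ≤ U`, `‖Δ_Wu‖_∞ ≤ B`; local gauges around every bond with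
`‖W^g − 1‖ ≤ a` on the cube of radius `R+1` and `‖div(W^g − 1)‖ ≤ δ` on the cube of radius `R`; `16Rda ≤ 1∕2`):
`‖D_Wu‖_∞ ≤ 4(2d∕R + 4Rδ + 24Rda² + 2a)·U + 4R·B`. [folklore] -/
theorem gaugeDir_le_raw [Nonempty n] (hd : 1 ≤ d) {P : ℕ} (hP : 1 ≤ P)
    {W : Site d → Fin d → (Matrix n n ℂ)ˣ} (hWu : IsUnitaryCfg W) (hWP : IsPeriodicCfg W (P : ℤ))
    {u : Site d → (Matrix n n ℂ)} (huP : ∀ (x : Site d) (i : Fin d), u (x + (P : ℤ) • e i) = u x)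
    {R : ℕ} (hR : 1 ≤ R) {a δ U B : ℝ} (ha0 : 0 ≤ a) (hU0 : 0 ≤ U)
    (hB : ∀ y : Site d, ‖covLapSite W u y‖ ≤ B) (hUu : ∀ y : Site d, ‖u y‖ ≤ U)
    (hgauge : ∀ (y₀ : Site d) (μ₀ : Fin d), ∃ g : Site d → (Matrix n n ℂ)ˣ, (∀ x, g x ∈ unitaryUnits (Matrix n n ℂ)) ∧
      (∀ (x : Site d) (ν : Fin d), (∀ i, |x i - y₀ i| ≤ (R : ℤ) + 1) → ‖((gaugeAct g W x ν : (Matrix n n ℂ)ˣ) : Matrix n n ℂ) - 1‖ ≤ a) ∧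
      (∀ x : Site d, (∀ i, |x i - y₀ i| ≤ (R : ℤ)) →
        ‖∑ ν : Fin d, ((((gaugeAct g W x ν : (Matrix n n ℂ)ˣ) : Matrix n n ℂ) - 1) - (((gaugeAct g W (x - e ν) ν : (Matrix n n ℂ)ˣ) : Matrix n n ℂ) - 1))‖ ≤ δ))
    (ha : 16 * R * d * a ≤ 1 / 2) :
    ∀ (x : Site d) (μ : Fin d), ‖gaugeDir W u x μ‖ ≤ 4 * (2 * (d : ℝ) / R + 4 * R * δ + 24 * R * d * a ^ 2 + 2 * a) * U + 4 * R * B := by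
  classical
  have hR0 : (0 : ℝ) < R := by exact_mod_cast hR
  have hd0 : (0 : ℝ) < d := by exact_mod_cast hd
  have hB0 : 0 ≤ B := (norm_nonneg _).trans (hB 0)
  have hδ0 : 0 ≤ δ := by
    obtain ⟨g, -, -, hdiv⟩ := hgauge 0 ⟨0, hd⟩
    exact (norm_nonneg _).trans (hdiv 0 fun i => by simp)
  -- the maximal covariant forward difference over one period
  set S : Finset (Site d × Fin d) := (periodBox (d := d) P) ×ˢ (Finset.univ : Finset (Fin d)) with hS_def
  have hmemS : ∀ (x : Site d) (i : Fin d), (cmod P x, i) ∈ S := fun x i => by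
    rw [hS_def, Finset.mem_product]
    exact ⟨(mem_periodBox).2 fun κ => ⟨cmod_nonneg hP x κ, cmod_lt hP x κ⟩, Finset.mem_univ _⟩
  have hSne : S.Nonempty := ⟨_, hmemS 0 ⟨0, hd⟩⟩
  obtain ⟨q₀, -, hq₀max⟩ := Finset.exists_max_image S (fun q => ‖gaugeDir W u q.1 q.2‖) hSne
  set G : ℝ := ‖gaugeDir W u q₀.1 q₀.2‖ with hG_def
  have hG0 : 0 ≤ G := norm_nonneg _
  have hYP : IsPeriodicDir (gaugeDir W u) (P : ℤ) := isPeriodicDir_gaugeDir hWP huP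
  have hGall : ∀ (x : Site d) (μ : Fin d), ‖gaugeDir W u x μ‖ ≤ G := by
    intro x μ
    have hx : x = cmod P x + (P : ℤ) • cdiv P x := by rw [add_comm, smul_cdiv_add_cmod]
    have h1 : gaugeDir W u x μ = gaugeDir W u (cmod P x) μ := by
      have h := periodic_smul_vec (f := fun z => gaugeDir W u z μ) (fun z κ => hYP z κ μ) (cmod P x) (cdiv P x)
      rw [← hx] at h
      exact h
    rw [h1]
    exact hq₀max (cmod P x, μ) (hmemS x μ)
  set K : ℝ := 2 * (d : ℝ) / R + 4 * R * δ + 24 * R * d * a ^ 2 + 2 * a with hK_def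
  have hK0 : 0 ≤ K := by rw [hK_def]; positivity
  -- either `G` is already below the `U`-term, or the closed theorem applies with `C_U = U / G`
  suffices hGle : G ≤ 4 * K * U + 4 * R * B from fun x μ => (hGall x μ).trans hGle
  by_cases hsmall : G ≤ 4 * K * U
  · nlinarith
  · push Not at hsmall
    have hGpos : 0 < G := lt_of_le_of_lt (by positivity) hsmall
    set CU : ℝ := U / G with hCU_def
    have hCU0 : 0 ≤ CU := div_nonneg hU0 hGpos.le
    have hUCU : ∀ s : ℝ, (∀ (x : Site d) (μ : Fin d), ‖gaugeDir W u x μ‖ ≤ s) → ∀ y : Site d, ‖u y‖ ≤ CU * s := by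
      intro s hs y
      have hGs : G ≤ s := hs q₀.1 q₀.2
      calc ‖u y‖ ≤ U := hUu y
        _ = CU * G := by rw [hCU_def]; field_simp
        _ ≤ CU * s := mul_le_mul_of_nonneg_left hGs hCU0
    have hline : 2 * (d : ℝ) * CU / R + (4 * R * δ + 24 * R * d * a ^ 2 + 2 * a) * CU + 8 * R * d * a ≤ 1 / 2 := by
      have h1 : 2 * (d : ℝ) * CU / R + (4 * R * δ + 24 * R * d * a ^ 2 + 2 * a) * CU = K * U / G := by
        rw [hCU_def, hK_def]; field_simp; ring
      have h2 : K * U / G ≤ 1 / 4 := by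
        rw [div_le_iff₀ hGpos]; nlinarith
      linarith
    have h := (supRegularity_of_localGauge hd hP hWu hWP huP hR ha0 hCU0 hB hUCU hgauge hline).1 q₀.1 q₀.2
    nlinarith

/-! ## §2 Scalar averaging on a cube -/

omit [Fintype n] [DecidableEq n] in
/-- `#[−R, R]^d = (2R+1)^d`. [folklore] -/
theorem card_cubeVecs (d R : ℕ) : ((Fintype.piFinset fun _ : Fin d => Finset.Icc (-(R : ℤ)) (R : ℤ)).card : ℝ) = (2 * (R : ℝ) + 1) ^ d := by
  rw [Fintype.card_piFinset, prod_const, card_univ, Fintype.card_fin, Int.card_Icc]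
  have h : ((R : ℤ) + 1 - -(R : ℤ)).toNat = 2 * R + 1 := by omega
  rw [h]; push_cast; ring

omit [Fintype n] [DecidableEq n] in
/-- Members of the cube have coordinates of size `≤ R`, so `Σ_i |m_i| ≤ d·R`. [folklore] -/
theorem sum_abs_le_of_mem_cubeVecs {d R : ℕ} {m : Site d} (hm : m ∈ Fintype.piFinset fun _ : Fin d => Finset.Icc (-(R : ℤ)) (R : ℤ)) : ∑ i, ((|m i| : ℤ) : ℝ) ≤ (d : ℝ) * R := by
  have h : ∀ i, ((|m i| : ℤ) : ℝ) ≤ R := by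
    intro i
    have hi := Fintype.mem_piFinset.mp hm i
    rw [Finset.mem_Icc] at hi
    have : |m i| ≤ (R : ℤ) := abs_le.mpr ⟨hi.1, hi.2⟩
    exact_mod_cast this
  calc ∑ i, ((|m i| : ℤ) : ℝ) ≤ ∑ _i : Fin d, (R : ℝ) := sum_le_sum fun i _ => h i
    _ = (d : ℝ) * R := by rw [sum_const, card_univ, Fintype.card_fin, nsmul_eq_mul]

/-- **SCALAR AVERAGING**: `(2R+1)^d·‖u(x₀)‖ ≤ Σ_{m ∈ [−R,R]^d}‖u(x₀+m)‖ + (2R+1)^d·(G·dR)` when all covariant forward differences are `≤ G` (`G ≥ 0`; the norm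
`y ↦ ‖u y‖` is `G`-Lipschitz for the `ℓ¹` distance, `abs_norm_sub_norm_le`). [folklore] -/
theorem card_mul_norm_le [Nonempty n] {W : Site d → Fin d → (Matrix n n ℂ)ˣ} (hWu : IsUnitaryCfg W) (u : Site d → Matrix n n ℂ) {G : ℝ} (hG0 : 0 ≤ G)
    (hG : ∀ (x : Site d) (μ : Fin d), ‖gaugeDir W u x μ‖ ≤ G) (x₀ : Site d) (R : ℕ) :
    (2 * (R : ℝ) + 1) ^ d * ‖u x₀‖ ≤ ∑ m ∈ (Fintype.piFinset fun _ : Fin d => Finset.Icc (-(R : ℤ)) (R : ℤ)), ‖u (x₀ + m)‖ + (2 * (R : ℝ) + 1) ^ d * (G * ((d : ℝ) * R)) := by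
  have hpt : ∀ m ∈ (Fintype.piFinset fun _ : Fin d => Finset.Icc (-(R : ℤ)) (R : ℤ)), ‖u x₀‖ ≤ ‖u (x₀ + m)‖ + G * ((d : ℝ) * R) := by
    intro m hm
    have h1 := abs_norm_sub_norm_le hWu u hG x₀ m
    have h2 : G * ∑ i, ((|m i| : ℤ) : ℝ) ≤ G * ((d : ℝ) * R) := mul_le_mul_of_nonneg_left (sum_abs_le_of_mem_cubeVecs hm) hG0
    rw [abs_le] at h1
    linarith [h1.1]
  calc (2 * (R : ℝ) + 1) ^ d * ‖u x₀‖ = ∑ _m ∈ (Fintype.piFinset fun _ : Fin d => Finset.Icc (-(R : ℤ)) (R : ℤ)), ‖u x₀‖ := by rw [sum_const, nsmul_eq_mul, card_cubeVecs]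
    _ ≤ ∑ m ∈ (Fintype.piFinset fun _ : Fin d => Finset.Icc (-(R : ℤ)) (R : ℤ)), (‖u (x₀ + m)‖ + G * ((d : ℝ) * R)) := sum_le_sum hpt
    _ = ∑ m ∈ (Fintype.piFinset fun _ : Fin d => Finset.Icc (-(R : ℤ)) (R : ℤ)), ‖u (x₀ + m)‖ + (2 * (R : ℝ) + 1) ^ d * (G * ((d : ℝ) * R)) := by
        rw [sum_add_distrib, sum_const, nsmul_eq_mul, card_cubeVecs]

/-- **THE CAUCHY–SCHWARZ FORM**: `Σ_{m}‖u(x₀+m)‖² ≤ S₂` ⟹ `‖u(x₀)‖ ≤ √(S₂∕(2R+1)^d) + G·dR`. [folklore] -/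
theorem norm_le_sqrt_add [Nonempty n] {W : Site d → Fin d → (Matrix n n ℂ)ˣ} (hWu : IsUnitaryCfg W) (u : Site d → Matrix n n ℂ) {G S₂ : ℝ}
    (hG0 : 0 ≤ G) (hG : ∀ (x : Site d) (μ : Fin d), ‖gaugeDir W u x μ‖ ≤ G) (x₀ : Site d) (R : ℕ)
    (hS : ∑ m ∈ (Fintype.piFinset fun _ : Fin d => Finset.Icc (-(R : ℤ)) (R : ℤ)), ‖u (x₀ + m)‖ ^ 2 ≤ S₂) :
    ‖u x₀‖ ≤ Real.sqrt (S₂ / (2 * (R : ℝ) + 1) ^ d) + G * ((d : ℝ) * R) := by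
  have hc : (0 : ℝ) < (2 * (R : ℝ) + 1) ^ d := by positivity
  have h1 := card_mul_norm_le hWu u hG0 hG x₀ R
  -- Cauchy–Schwarz: `(Σ ‖u‖)² ≤ card · Σ ‖u‖²`
  have hcs : (∑ m ∈ (Fintype.piFinset fun _ : Fin d => Finset.Icc (-(R : ℤ)) (R : ℤ)), ‖u (x₀ + m)‖) ^ 2 ≤ (2 * (R : ℝ) + 1) ^ d * S₂ := by
    have h := sq_sum_le_card_mul_sum_sq (s := (Fintype.piFinset fun _ : Fin d => Finset.Icc (-(R : ℤ)) (R : ℤ))) (f := fun m => ‖u (x₀ + m)‖)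
    rw [card_cubeVecs] at h
    exact h.trans (mul_le_mul_of_nonneg_left hS hc.le)
  have h2 : ∑ m ∈ (Fintype.piFinset fun _ : Fin d => Finset.Icc (-(R : ℤ)) (R : ℤ)), ‖u (x₀ + m)‖ ≤ (2 * (R : ℝ) + 1) ^ d * Real.sqrt (S₂ / (2 * (R : ℝ) + 1) ^ d) := by
    have e : (2 * (R : ℝ) + 1) ^ d * Real.sqrt (S₂ / (2 * (R : ℝ) + 1) ^ d) = Real.sqrt ((2 * (R : ℝ) + 1) ^ d * S₂) := by
      rw [show (2 * (R : ℝ) + 1) ^ d * S₂ = ((2 * (R : ℝ) + 1) ^ d) ^ 2 * (S₂ / (2 * (R : ℝ) + 1) ^ d) by field_simp,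
        Real.sqrt_mul (sq_nonneg _), Real.sqrt_sq hc.le]
    rw [e]
    exact Real.le_sqrt_of_sq_le hcs
  have h3 : (2 * (R : ℝ) + 1) ^ d * ‖u x₀‖ ≤ (2 * (R : ℝ) + 1) ^ d * (Real.sqrt (S₂ / (2 * (R : ℝ) + 1) ^ d) + G * ((d : ℝ) * R)) := by
    rw [mul_add]; linarith
  exact le_of_mul_le_mul_left h3 hc

/-! ## §3 The mean-value inequality on the torus -/

/-- **THE COVARIANT LATTICE MEAN-VALUE INEQUALITY ON THE TORUS** (`d ≥ 1`; `W` unitary `P`-periodic; `u` `P`-periodic; local gauges of radius `R′` as in §1 with `16R′da ≤ 1∕2`;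
cube sums `Σ_{m ∈ [−R,R]^d}‖u(x₀+m)‖² ≤ S₂` for every `x₀`; and the line `4dR·(2d∕R′ + 4R′δ + 24R′da² + 2a) ≤ 1∕2`):
`‖u‖_∞ ≤ 2√(S₂∕(2R+1)^d) + 8dRR′·‖Δ_Wu‖_∞`. [folklore] -/
theorem sup_le_meanValue [Nonempty n] (hd : 1 ≤ d) {P : ℕ} (hP : 1 ≤ P)
    {W : Site d → Fin d → (Matrix n n ℂ)ˣ} (hWu : IsUnitaryCfg W) (hWP : IsPeriodicCfg W (P : ℤ))
    {u : Site d → (Matrix n n ℂ)} (huP : ∀ (x : Site d) (i : Fin d), u (x + (P : ℤ) • e i) = u x)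
    {R R' : ℕ} (hR' : 1 ≤ R') {a δ B S₂ : ℝ} (ha0 : 0 ≤ a)
    (hB : ∀ y : Site d, ‖covLapSite W u y‖ ≤ B)
    (hgauge : ∀ (y₀ : Site d) (μ₀ : Fin d), ∃ g : Site d → (Matrix n n ℂ)ˣ, (∀ x, g x ∈ unitaryUnits (Matrix n n ℂ)) ∧
      (∀ (x : Site d) (ν : Fin d), (∀ i, |x i - y₀ i| ≤ (R' : ℤ) + 1) → ‖((gaugeAct g W x ν : (Matrix n n ℂ)ˣ) : Matrix n n ℂ) - 1‖ ≤ a) ∧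
      (∀ x : Site d, (∀ i, |x i - y₀ i| ≤ (R' : ℤ)) →
        ‖∑ ν : Fin d, ((((gaugeAct g W x ν : (Matrix n n ℂ)ˣ) : Matrix n n ℂ) - 1) - (((gaugeAct g W (x - e ν) ν : (Matrix n n ℂ)ˣ) : Matrix n n ℂ) - 1))‖ ≤ δ))
    (ha : 16 * R' * d * a ≤ 1 / 2)
    (hS : ∀ x₀ : Site d, ∑ m ∈ (Fintype.piFinset fun _ : Fin d => Finset.Icc (-(R : ℤ)) (R : ℤ)), ‖u (x₀ + m)‖ ^ 2 ≤ S₂)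
    (hline : 4 * (d : ℝ) * R * (2 * (d : ℝ) / R' + 4 * R' * δ + 24 * R' * d * a ^ 2 + 2 * a) ≤ 1 / 2) :
    ∀ y : Site d, ‖u y‖ ≤ 2 * Real.sqrt (S₂ / (2 * (R : ℝ) + 1) ^ d) + 8 * (d : ℝ) * R * R' * B := by
  classical
  -- the sup of `u` over one period is attained
  have hne : (periodBox (d := d) P).Nonempty := ⟨cmod P 0, (mem_periodBox).2 fun κ => ⟨cmod_nonneg hP 0 κ, cmod_lt hP 0 κ⟩⟩
  obtain ⟨x₀, -, hx₀max⟩ := Finset.exists_max_image (periodBox (d := d) P) (fun y => ‖u y‖) hne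
  set U : ℝ := ‖u x₀‖ with hU_def
  have hU0 : 0 ≤ U := norm_nonneg _
  have hUall : ∀ y : Site d, ‖u y‖ ≤ U := by
    intro y
    have hy : y = cmod P y + (P : ℤ) • cdiv P y := by rw [add_comm, smul_cdiv_add_cmod]
    have h1 : u y = u (cmod P y) := by
      have h := periodic_smul_vec (f := u) huP (cmod P y) (cdiv P y)
      rw [← hy] at h
      exact h
    rw [h1]
    exact hx₀max _ ((mem_periodBox).2 fun κ => ⟨cmod_nonneg hP y κ, cmod_lt hP y κ⟩)
  -- §1: the raw gradient estimate with this `U`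
  set K : ℝ := 2 * (d : ℝ) / R' + 4 * R' * δ + 24 * R' * d * a ^ 2 + 2 * a with hK_def
  have hG := gaugeDir_le_raw hd hP hWu hWP huP hR' ha0 hU0 hB hUall hgauge ha
  have hB0 : 0 ≤ B := (norm_nonneg _).trans (hB 0)
  have hK0 : 0 ≤ 4 * K * U + 4 * R' * B := (norm_nonneg _).trans (hG 0 ⟨0, hd⟩)
  -- §2 at the maximiser
  have hmv := norm_le_sqrt_add hWu u hK0 hG x₀ R (hS x₀)
  -- close: `U ≤ √… + dR·(4KU + 4R′B)` and `4dRK ≤ 1/2`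
  have h1 : U ≤ Real.sqrt (S₂ / (2 * (R : ℝ) + 1) ^ d) + (4 * K * U + 4 * R' * B) * ((d : ℝ) * R) := hmv
  have h2 : (4 * K * U) * ((d : ℝ) * R) ≤ U / 2 := by
    have : 4 * (d : ℝ) * R * K ≤ 1 / 2 := hline
    nlinarith
  intro y
  refine (hUall y).trans ?_
  nlinarith [Real.sqrt_nonneg (S₂ / (2 * (R : ℝ) + 1) ^ d)]

end

end Summit.QuantumFields.BalabanUV.T4Continuum.NE3.CovariantMeanValue
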